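import Summits.QuantumFields.YangMills.Theorems.ColdStartUniversalityShenZhuZhuUniqueLimitSU2
import HarnessLib

/-!
# Uniqueness AND existence of the infinite-volume limit of `SU(N)` lattice Yang–Mills for EVERY `N ≥ 2` and EVERY `d ≥ 2` at strong coupling
# (`|β| < 1/(16(d−1))`): `HasUniqueInfiniteVolumeLimit (fundamentalRep (Fin N)) (Nβ)`; the named fact `shenZhuZhu_uniqueLimit d 2` for every `d`

Seat `ym-line-csu-p1` (g39), route `ColdStartUniversality` of `Summits/QuantumFields/YangMills`, helper file G27 (strong coupling;
`--supports stmt-QuantumFields-24809`).  g38's G13 proved the soft half of Shen–Zhu–Zhu's Theorem 1.2 (2) in general (a unique limit point is THE limit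
of the full sequence of torus states, `hasUniqueInfiniteVolumeLimit_of_subsingleton`) but instantiated it only for `(d, N) = (3, 2)`.  The deep half —
the limit points form a subsingleton — is the tree's `subsingleton_infiniteVolumeLimitPoints_SU` for EVERY `d ≥ 2`, `N ≥ 2` (Dobrushin route,
`shen_zhu_zhu_holds`).  Hence:

* ★★★ `hasUniqueInfiniteVolumeLimit_sun` — for every `d ≥ 2`, `N ≥ 2` and 't Hooft `|β| < 1/(16(d−1))`, the torus `SU(N)` Wilson states at tree coupling
  `Nβ` CONVERGE, as `L → ∞`, to a probability measure which is the only infinite-volume limit point (SZZ Theorem 1.2 (2), intended content, all `N, d`).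
* ★★★ `shenZhuZhu_uniqueLimit_two` — the NAMED FACT `shenZhuZhu_uniqueLimit d 2` for every `d` (the `SO(2)` conjunct is vacuous; as typed the second half of
  the `SU` conjunct is `Sweep1`'s free-boundary subsequential-limit predicate, inhabited by compactness — g38's flag stands).

THEOREMS ONLY, no definition, no sorry.  HONEST FRAMING: STRONG coupling, lattice; the deep input is the tree's DLR uniqueness; nothing at weak coupling /
in the continuum, nothing `K`-uniform along the route's scaling (`UniformColdStartMixing`, 24809, ASIDE, not restated); no crux, rung or summit statement
is proved; the Yang–Mills mass gap is NOT proved.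

References: H. Shen, R. Zhu, X. Zhu, CMP 400 (2023) 805–851 = arXiv:2204.12737, Theorem 1.2 (2) [ShenZhuZhu2022].
-/

set_option autoImplicit false

noncomputable section

namespace Summit.QuantumFields.YangMills.Theorems.ColdStartUniversality

open MeasureTheory Filter Set Function
open scoped Topology
open Literature.MathematicalPhysics.QuantumFieldTheory
open Literature.MathematicalPhysics.QuantumLattice (fundamentalRep continuous_fundamentalRep infiniteVolumeLimitPoints HasUniqueInfiniteVolumeLimit)

variable {d N : ℕ}

/-- ★★★ **Shen–Zhu–Zhu Theorem 1.2 (2) for EVERY `SU(N)`, `N ≥ 2`, and EVERY `d ≥ 2`** (intended content, tree vocabulary `HasUniqueInfiniteVolumeLimit`):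
for 't Hooft `|β| < 1/(16(d−1))` the periodic `SU(N)` Wilson states at tree coupling `Nβ` converge, as `L → ∞`, to a probability measure `μ` on
`SU(N)^{E⁺(ℤ^d)}` which is the unique infinite-volume limit point.  Deep input: the tree's DLR uniqueness (`subsingleton_infiniteVolumeLimitPoints_SU`);
soft input: g38's `hasUniqueInfiniteVolumeLimit_of_subsingleton`.  The Yang–Mills mass gap is NOT proved. [cite: ShenZhuZhu2022, Theorem 1.2] -/
theorem hasUniqueInfiniteVolumeLimit_sun (hd : 2 ≤ d) (hN : 2 ≤ N) {β : ℝ} (hβ : |β| < szzThresholdSU d) :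
    HasUniqueInfiniteVolumeLimit (d := d) (fundamentalRep (Fin N)) ((N : ℝ) * β) := by
  haveI : SecondCountableTopology (Matrix (Fin N) (Fin N) ℂ) := inferInstanceAs (SecondCountableTopology (Fin N → Fin N → ℂ))
  haveI : SecondCountableTopology (Matrix.specialUnitaryGroup (Fin N) ℂ) := Topology.IsEmbedding.subtypeVal.secondCountableTopology
  exact hasUniqueInfiniteVolumeLimit_of_subsingleton (d := d) (fundamentalRep (Fin N)) (continuous_fundamentalRep (Fin N)) _
    (subsingleton_infiniteVolumeLimitPoints_SU (d := d) (N := N) hd hN hβ)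

/-- The same on the sharp numerical window of `d = 4`: `|β| < 1/48` ('t Hooft), every `N ≥ 2`. [cite: ShenZhuZhu2022, Theorem 1.2] -/
theorem hasUniqueInfiniteVolumeLimit_sun_d4 (hN : 2 ≤ N) {β : ℝ} (hβ : |β| < 1 / 48) :
    HasUniqueInfiniteVolumeLimit (d := 4) (fundamentalRep (Fin N)) ((N : ℝ) * β) := by
  have hT : szzThresholdSU 4 = 1 / 48 := by norm_num [szzThresholdSU]
  exact hasUniqueInfiniteVolumeLimit_sun (d := 4) (by norm_num) hN (by rw [hT]; exact hβ)

/-- ★★★ **The named fact `shenZhuZhu_uniqueLimit d 2` (Shen–Zhu–Zhu CMP 400 (2023), Theorem 1.2 (2)) for `SU(2)` in EVERY dimension `d`**: the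
limit points form a subsingleton (tree, Dobrushin route) and — as typed — a free-boundary subsequential limit exists (compactness, g38); the `SO(2)`
conjunct is vacuous (threshold `1/(32(d−1)) − 1/(32(d−1)) = 0`).  g38 proved `d = 3`.  STRONG coupling; the Yang–Mills mass gap is NOT proved.
[cite: ShenZhuZhu2022, Theorem 1.2] -/
theorem shenZhuZhu_uniqueLimit_two : shenZhuZhu_uniqueLimit d 2 := by
  refine ⟨fun hd _ β hβ => ?_, fun hd _ β hβ => ?_⟩
  · haveI : SecondCountableTopology (Matrix (Fin 2) (Fin 2) ℂ) := inferInstanceAs (SecondCountableTopology (Fin 2 → Fin 2 → ℂ))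
    haveI : SecondCountableTopology (Matrix.specialUnitaryGroup (Fin 2) ℂ) := Topology.IsEmbedding.subtypeVal.secondCountableTopology
    exact ⟨subsingleton_infiniteVolumeLimitPoints_SU (d := d) (N := 2) hd (le_refl 2) hβ,
      exists_freeBoundary_infiniteVolumeLimit (d := d) (fundamentalRep (Fin 2)) (continuous_fundamentalRep (Fin 2)) _⟩
  · exfalso
    have hT : szzThresholdSO 2 d = 0 := by simp only [szzThresholdSO]; ring
    rw [hT] at hβ
    exact absurd hβ (not_lt.2 (abs_nonneg β))

end Summit.QuantumFields.YangMills.Theorems.ColdStartUniversality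

end
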